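import Literature.NumberTheory.GaloisRepresentations.ChebotarevCyclicProofs
import Literature.NumberTheory.GaloisRepresentations.ChebotarevCyclotomicProofs
import Literature.NumberTheory.Automorphic.SatakeParamNeZeroProofs
import Literature.NumberTheory.Automorphic.AutomorphicRepsGLSatakeFlathProofs
import Mathlib.RingTheory.RootsOfUnity.Complex
import HarnessLib

/-!
# Self-twist rank split — heart: a self-twisting cyclic layer has degree dividing the rank
# (PROVED wall of node `SelfTwistRankSplit`, decomp-langlands lens-4 gen 38)

Pure number theory, no route namespace is opened.  The items
`CyclicLayerPeeling.SelfTwistedLayerDescent` (stmt-Langlands-27862) and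
`GaloisHullLift.SelfTwistedHullDescent` (stmt-Langlands-28226) carry the *self-twist guard*: along a
cyclic layer `F/K` of prime degree `p` the Satake multisets `α_v` of the cuspidal `π` on `GL_n/K` are
stable under multiplication by `ζ_p = exp(2πi/p)` at almost every place `v` of `K` inert in `F`.
This file proves that such a guard forces `p ∣ n`:

* §1 `pow_card_eq_one_of_map_mul_eq`, `dvd_card_of_map_mul_eq`: a multiset of non-zero elements of a
  domain stable under `z ↦ ζ z` has `ζ ^ card = 1` (take the product), hence `ord ζ ∣ card`;
  `map_mul_pow_eq_of_map_mul_eq`: stability under `ζ` gives stability under every power of `ζ`.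
* §2 `inertiaDeg_ne_one_of_frobenius_eq`: if every arithmetic Frobenius at `Q ∣ q` equals a fixed
  `g ≠ 1`, then `f(Q|q) ≠ 1` (at `f = 1` the identity is a Frobenius: `x ^ N(Q) ≡ x (mod Q)`).
* §3 `infinite_setOf_inert`: a cyclic extension `L/M` of number fields of degree `> 1` has infinitely
  many primes `q` all of whose overprimes have residue degree `≠ 1` — the tree's PROVED cyclic
  Chebotarev theorem `infinite_setOf_frobenius_eq_of_isCyclic chebotarev_cyclotomicExtension_holds`
  applied to a generator `g ≠ 1`, and §2.
* §4 `finrank_dvd_of_selfTwistGuard`: the guard (verbatim shape of the two items, `F` any cyclic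
  Galois extension of `K` of degree `d > 1`) implies `d ∣ n`: at one inert place where `π` is
  unramified (a.e., Flath: `hasSatakeParamAt_cofinite_holds`) the Satake multiset has `n` non-zero
  entries (`HasSatakeParamAt.card_eq`, `hasSatakeParamAt_ne_zero_holds`) and is `ζ_d`-stable, so
  `ζ_d ^ n = 1` (§1) and `d ∣ n` (`Complex.isPrimitiveRoot_exp`).

Consequence used by the node: the sector `p ∤ n` of the two self-twisted items is CLOSED (vacuous),
and the divisibility `l ∣ n` that the tree's rendering of Arthur–Clozel, Ch. 3, Thm. 4.2 (b)
(`ArthurClozel1989_automorphicInduction_of_selfTwist`, hypothesis `n = m * [E:F]`) assumes is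
supplied unconditionally from the Satake-level self-twist.  Arthur–Clozel 1989, Ch. 3, Lemma 6.4 and
(6.6) (`t_{π,v}^l` at inert `v`); Marcus, *Number Fields*, Ch. 4, Thm. 32 (Frobenius).
-/

set_option linter.dupNamespace false

open NumberField IsDedekindDomain Filter
open scoped Classical

namespace Summit.Langlands.Langlands.Theorems.SelfTwistRankSplit

open Literature.NumberTheory.GaloisRepresentations Literature.NumberTheory.Automorphic

/-! ## §1 `ζ`-stable multisets of non-zero elements -/

/-- A multiset of non-zero elements of a domain stable under `z ↦ ζ z` satisfies `ζ ^ card = 1`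
(compare products). [folklore] -/
theorem pow_card_eq_one_of_map_mul_eq {R : Type*} [CommRing R] [IsDomain R] {ζ : R}
    {α : Multiset R} (h0 : (0 : R) ∉ α) (h : α.map (fun z => ζ * z) = α) :
    ζ ^ Multiset.card α = 1 := by
  have hprod : (α.map (fun z => ζ * z)).prod = ζ ^ Multiset.card α * α.prod := by
    rw [Multiset.prod_map_mul, Multiset.map_const', Multiset.prod_replicate, Multiset.map_id']
  rw [h] at hprod
  exact mul_right_cancel₀ (Multiset.prod_ne_zero h0) (hprod.symm.trans (one_mul α.prod).symm)

/-- A multiset of non-zero elements of a domain stable under multiplication by a primitive `k`-th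
root of unity has cardinality divisible by `k`. [folklore] -/
theorem dvd_card_of_map_mul_eq {R : Type*} [CommRing R] [IsDomain R] {ζ : R} {k : ℕ}
    (hζ : IsPrimitiveRoot ζ k) {α : Multiset R} (h0 : (0 : R) ∉ α)
    (h : α.map (fun z => ζ * z) = α) : k ∣ Multiset.card α :=
  (hζ.pow_eq_one_iff_dvd _).1 (pow_card_eq_one_of_map_mul_eq h0 h)

/-- Stability under `z ↦ ζ z` gives stability under `z ↦ ζ ^ i z`. [folklore] -/
theorem map_mul_pow_eq_of_map_mul_eq {R : Type*} [CommMonoid R] {ζ : R} {α : Multiset R}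
    (h : α.map (fun z => ζ * z) = α) (i : ℕ) : α.map (fun z => ζ ^ i * z) = α := by
  induction i with
  | zero => simp
  | succ i ih =>
    have hcomp : (fun z : R => ζ ^ (i + 1) * z) = (fun z => ζ * z) ∘ (fun z => ζ ^ i * z) := by
      funext z
      rw [Function.comp_apply, pow_succ', mul_assoc]
    rw [hcomp, ← Multiset.map_map, ih, h]

/-- Stability under one primitive `k`-th root of unity gives stability under all of them.
[folklore] -/
theorem map_mul_eq_of_isPrimitiveRoot {R : Type*} [CommRing R] [IsDomain R] {ζ ξ : R} {k : ℕ}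
    [NeZero k] (hζ : IsPrimitiveRoot ζ k) (hξ : IsPrimitiveRoot ξ k) {α : Multiset R}
    (h : α.map (fun z => ζ * z) = α) : α.map (fun z => ξ * z) = α := by
  obtain ⟨i, -, rfl⟩ := hζ.eq_pow_of_pow_eq_one hξ.pow_eq_one
  exact map_mul_pow_eq_of_map_mul_eq h i

/-! ## §2 Frobenius `≠ 1` forces residue degree `≠ 1` -/

section Inert

variable {M L : Type} [Field M] [NumberField M] [Field L] [NumberField L] [Algebra M L]

/-- If every arithmetic Frobenius of `L/M` at a prime `Q ∣ q` of `𝓞 L` equals a fixed `g ≠ 1`, then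
the residue degree `f(Q|q)` is not `1`: if it were, `#(𝓞 L/Q) = #(𝓞 M/q)` and `x ^ #(𝓞 M/q) ≡ x
(mod Q)` for all `x`, i.e. the identity is a Frobenius at `Q`. Marcus, *Number Fields*, Ch. 4,
Thm. 32. [folklore] -/
theorem inertiaDeg_ne_one_of_frobenius_eq {q : HeightOneSpectrum (𝓞 M)} {Q : Ideal (𝓞 L)}
    (hQ : Q ∈ q.asIdeal.primesOver (𝓞 L)) {g : L ≃ₐ[M] L} (hg1 : g ≠ 1)
    (hfrob : ∀ φ : L ≃ₐ[M] L, IsArithFrobAt (𝓞 M) φ Q → φ = g) :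
    Q.inertiaDeg (𝓞 M) ≠ 1 := by
  intro hf
  haveI := hQ.1
  haveI := hQ.2
  haveI : q.asIdeal.IsMaximal := q.isMaximal
  have hQne : Q ≠ ⊥ := Ideal.ne_bot_of_mem_primesOver q.ne_bot hQ
  haveI : Q.IsMaximal := hQ.1.isMaximal hQne
  -- the residue fields have the same cardinality
  have hcard : Nat.card (𝓞 M ⧸ Q.under (𝓞 M)) = Nat.card (𝓞 L ⧸ Q) := by
    have h := Ideal.cardQuot_pow_inertiaDeg (R := 𝓞 M) q.asIdeal Q
    rw [hf, pow_one, Submodule.cardQuot_apply, Submodule.cardQuot_apply] at h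
    rw [← hQ.2.over]
    exact h
  -- hence the identity is a Frobenius at `Q`
  have hid : IsArithFrobAt (𝓞 M) (1 : L ≃ₐ[M] L) Q := by
    letI : Field (𝓞 L ⧸ Q) := Ideal.Quotient.field Q
    haveI : Finite (𝓞 L ⧸ Q) := Ideal.finiteQuotientOfFreeOfNeBot Q hQne
    letI : Fintype (𝓞 L ⧸ Q) := Fintype.ofFinite _
    intro x
    rw [MulSemiringAction.toAlgHom_apply, one_smul, hcard, ← Ideal.Quotient.eq_zero_iff_mem,
      map_sub, map_pow, Nat.card_eq_fintype_card, FiniteField.pow_card, sub_self]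
  exact hg1 (hfrob 1 hid).symm

variable [IsGalois M L]

/-- **Inert primes of a cyclic extension are infinite in number**: for `L/M` cyclic of degree `> 1`
there are infinitely many primes `q` of `M` all of whose overprimes in `L` have residue degree `≠ 1`
— the tree's proved cyclic Chebotarev theorem (`infinite_setOf_frobenius_eq_of_isCyclic` with
`chebotarev_cyclotomicExtension_holds`) at a generator `g ≠ 1` of `Gal(L/M)`, and
`inertiaDeg_ne_one_of_frobenius_eq`. [folklore] -/
theorem infinite_setOf_inert (hML : 1 < Module.finrank M L) (hcyc : IsCyclic (L ≃ₐ[M] L)) :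
    {q : HeightOneSpectrum (𝓞 M) |
      ∀ Q ∈ q.asIdeal.primesOver (𝓞 L), Q.inertiaDeg (𝓞 M) ≠ 1}.Infinite := by
  haveI := hcyc
  haveI : FiniteDimensional M L := Module.Finite.of_restrictScalars_finite ℚ M L
  obtain ⟨g, hg⟩ := IsCyclic.exists_generator (α := L ≃ₐ[M] L)
  have hg1 : g ≠ 1 := by
    intro h1
    have hord := orderOf_eq_card_of_forall_mem_zpowers hg
    rw [h1, orderOf_one, IsGalois.card_aut_eq_finrank] at hord
    omega
  refine Set.Infinite.mono ?_
    (infinite_setOf_frobenius_eq_of_isCyclic chebotarev_cyclotomicExtension_holds g hg)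
  intro q hq Q hQ
  exact inertiaDeg_ne_one_of_frobenius_eq hQ hg1 (hq.2.2 Q hQ)

/-- `HeightOneSpectrum` form of `infinite_setOf_inert`: infinitely many `q` such that every place
`w` of `L` with `w ∩ 𝓞 M = q` has residue degree `≠ 1` (the shape of the items' guard).
[folklore] -/
theorem infinite_setOf_inert' (hML : 1 < Module.finrank M L) (hcyc : IsCyclic (L ≃ₐ[M] L)) :
    {q : HeightOneSpectrum (𝓞 M) | ∀ w : HeightOneSpectrum (𝓞 L),
      w.asIdeal.under (𝓞 M) = q.asIdeal → w.asIdeal.inertiaDeg (𝓞 M) ≠ 1}.Infinite := by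
  refine Set.Infinite.mono ?_ (infinite_setOf_inert hML hcyc)
  intro q hq w hw
  exact hq w.asIdeal ⟨w.isPrime, ⟨hw.symm⟩⟩

end Inert

/-! ## §4 The wall: a self-twisting cyclic layer has degree dividing the rank -/

/-- **PROVED WALL.** Let `π` be a cuspidal automorphic representation datum of `GL_n(𝔸_K)` and
`F/K` a cyclic Galois extension of number fields of degree `d > 1` such that, at almost every place
`v` of `K` inert in `F` (every `w ∣ v` has residue degree `≠ 1`), every Satake multiset of `π` at
`v` is stable under multiplication by `exp(2πi/d)`.  Then `d ∣ n`.  (At one such `v` where `π` is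
unramified — inert places are infinite by cyclic Chebotarev, unramified ones cofinite by Flath — the
Satake multiset has `n` non-zero entries and is `ζ_d`-stable, so `ζ_d ^ n = 1`.)  This is the
divisibility `l ∣ n` implicit in Arthur–Clozel 1989, Ch. 3, Lemma 6.4/(6.6), obtained here from the
Satake-level self-twist alone. [folklore] -/
theorem finrank_dvd_of_selfTwistGuard {K : Type} [Field K] [NumberField K] {n : ℕ}
    {hcpt : isCompact_glFiniteIntegralLevel n K} (π : CuspidalAutomorphicRepData n K hcpt)
    (F : Type) [Field F] [NumberField F] [Algebra K F] [IsGalois K F]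
    (hcyc : IsCyclic (F ≃ₐ[K] F)) (hF : 1 < Module.finrank K F)
    (hguard : ∀ᶠ v : HeightOneSpectrum (𝓞 K) in cofinite,
      (∀ w : HeightOneSpectrum (𝓞 F), w.asIdeal.under (𝓞 K) = v.asIdeal →
          w.asIdeal.inertiaDeg (𝓞 K) ≠ 1) →
        ∀ α : Multiset ℂ, π.1.HasSatakeParamAt v α →
          α.map (fun z => Complex.exp (2 * Real.pi * Complex.I / (Module.finrank K F : ℂ)) * z) = α) :
    Module.finrank K F ∣ n := by
  have hinf := infinite_setOf_inert' (M := K) (L := F) hF hcyc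
  have hunr := π.1.hasSatakeParamAt_cofinite_holds
  obtain ⟨v, hv, hvg, hvu⟩ :=
    ((Set.infinite_iff_frequently_cofinite.1 hinf).and_eventually (hguard.and hunr)).exists
  obtain ⟨α, hα⟩ := hvu
  have hstab := hvg hv α hα
  have hcard : Multiset.card α = n := hα.card_eq
  have h0 : (0 : ℂ) ∉ α := fun h => hasSatakeParamAt_ne_zero_holds hα 0 h rfl
  have hζ : IsPrimitiveRoot (Complex.exp (2 * Real.pi * Complex.I / (Module.finrank K F : ℂ)))
      (Module.finrank K F) :=
    Complex.isPrimitiveRoot_exp _ (by omega)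
  rw [← hcard]
  exact dvd_card_of_map_mul_eq hζ h0 hstab

/-- **The coprime sector is void**: under the hypotheses of `finrank_dvd_of_selfTwistGuard` with
`d` prime and `¬ d ∣ n`, anything follows. [folklore] -/
theorem selfTwistGuard_absurd {K : Type} [Field K] [NumberField K] {n : ℕ}
    {hcpt : isCompact_glFiniteIntegralLevel n K} (π : CuspidalAutomorphicRepData n K hcpt)
    (F : Type) [Field F] [NumberField F] [Algebra K F] [IsGalois K F]
    (hcyc : IsCyclic (F ≃ₐ[K] F)) (hp : (Module.finrank K F).Prime)
    (hguard : ∀ᶠ v : HeightOneSpectrum (𝓞 K) in cofinite,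
      (∀ w : HeightOneSpectrum (𝓞 F), w.asIdeal.under (𝓞 K) = v.asIdeal →
          w.asIdeal.inertiaDeg (𝓞 K) ≠ 1) →
        ∀ α : Multiset ℂ, π.1.HasSatakeParamAt v α →
          α.map (fun z => Complex.exp (2 * Real.pi * Complex.I / (Module.finrank K F : ℂ)) * z) = α)
    (hndvd : ¬ Module.finrank K F ∣ n) {C : Prop} : C :=
  absurd (finrank_dvd_of_selfTwistGuard π F hcyc hp.one_lt hguard) hndvd

end Summit.Langlands.Langlands.Theorems.SelfTwistRankSplit
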